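import Summits.Ventures.LatticeQCDFlow.Scaling.ConveyorLadder

/-!
HONEST FRAMING: exact (Metropolis-corrected) sampling algorithms for lattice gauge theory; figures
of merit are autocorrelation/cost numbers at stated couplings and volumes; no continuum-physics
claim.

# ConveyorRotation — THE CONVEYOR POINCARÉ INEQUALITY WITHOUT THE COOLING FACTOR `q^K`: ROTATION PATHS
# (RELABEL FIRST, RIDE THE FRESH LABEL DOWN, RIDE THE OLD LABEL UP, RELABEL LAST) COST THE HEATING
# PERSISTENCE `p` AND A ONE-LEVEL BLOCK-HEATING FACTOR `U` ONLY (lean-2 GEN-18, ours)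

Venture-side (OURS).  Cell `lqcd-flow` (pub-lqcd), unit `pub-lqcd-lean-2-g18`, 2026-08-25.  Fourth file of chapter C
(after `Scaling/ConveyorLadder`, `Scaling/ConveyorLegs`, `Scaling/ConveyorPoincare`).  Same setting as
`Scaling/ConveyorPoincare`: mode assignments `z : Fin (K+1) → J`, product law `ν⊗ = tensorFun ν`, a matrix `Q ≥ 0`
whose transposition flows satisfy `ν⊗(z)Q(z, z∘σ_l) ≥ κ·min{ν⊗(z), ν⊗(z∘σ_l)}` and whose hot-relabel flows dominate
`θ×` those of a `ν_0`-chain `Q₀` of Poincaré constant `ρ`; persistence under heating `p·ν_k(j) ≤ ν_i(j)` (`i ≤ k`).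

WHY A SECOND PROOF.  `Scaling/ConveyorPoincare.conveyor_poincare_of_cooling` pays the DISPLACEMENT FACTOR
`D = q^K` (`q·ν_l ≤ ν_{l+1}`): its comparison path first rides the OLD label of level `k` up to the hot end, which
pushes every label above it one level COLDER at the same time; for labels that are rare at the cold end (the
non-trivial topological sectors at fine lattice spacing) `q^K = e^{−R}` is the full hot-to-cold suppression, although
the exact spectral gap of the label conveyor does not degrade with `R` at all.  Here the path is ROTATED: relabel
the hot position to the fresh label `v` first, ride `v` DOWN to level `k` (the labels it passes move one level
HOTTER), ride the old label `o` UP from level `k−1` to the hot end (they move back), relabel `o` to the original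
hot label.  Every intermediate state is `insertNth t v r` or `insertNth t o r̂` with `r` the labels of levels
`1..K` and `r̂ = update r (k−1) v`, and its weight is at least `(p/U)×` the weight of the pair it serves, where
**`U` bounds the cost of reading a block of labels one level hotter: `Π_i ν_{i+1}(r_i) ≤ U·Π_i ν_{t.succAbove i}(r_i)`
for every `t`** (`U = M^K` if `ν_{l+1}(j) ≤ M·ν_l(j)`, `M ≥ 1` — the one-level GROWTH bound; labels that DECAY
towards the cold end cost nothing).  For the lattice application (`J` = topological sectors, only the trivial
sector gains weight towards the cold end) `U ≈ b_K(0)/b_0(0) ≤ 1/b_0(0)` is the inverse hot mass of the trivial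
sector, a constant, where `q^K` was exponentially small in the barrier.

## What is proved

* `insertNth_succ_eq_insertNth_castSucc_update` — `insertNth (j+1) v r = insertNth j (r j) (update r j v)`: after
  the fresh label has passed level `j+1` the state is the old label `r j` inserted at level `j` into the updated
  rest; `sum_update_swap_eq` — the involution `(r, v) ↦ (update r j v, r j)` reindexes double sums.
* `prod_succ_le_growth` — `U = M^K` under one-level growth `ν_{l+1}(j) ≤ M·ν_l(j)`, `1 ≤ M`.
* **`rotation_arm_le`** — for `m ≤ k`:
  `Σ_r Σ_v (Π_iν_{i+1}(r_i))ν_k(v)(f(insertNth 0 v r) − f(insertNth m v r))² ≤ (mU/(pκ))·Σ_l Σ_w ν⊗(w)Q(w,w∘σ_l)(f w − f(w∘σ_l))²`.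
* **`rotation_source_le`** —
  `Σ_r Σ_a Σ_v ν_0(a)(Π_iν_{i+1}(r_i))ν_k(v)(f(insertNth 0 a r) − f(insertNth 0 v r))² ≤ (2/(pρθ))·½Σ_zΣ_v ν⊗(z)Q(z,z⁰ᵛ)(f z − f z⁰ᵛ)²`.
* **`conveyor_poincare_rot`** — `C·Var_{ν⊗}(f) ≤ 𝓔_{ν⊗}(Q; f)` for every `C ≥ 0` with `C·16K(K+1)U ≤ pκ` and
  `C·16(K+1) ≤ pρθ`: **the Poincaré constant is at least `(p/(16(K+1)))·min{κ/(KU), ρθ}`** — no `q`, no `D`.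
* **`conveyor_poincare_of_growth`** — the same with `U = M^K` under one-level growth `ν_{l+1}(j) ≤ M·ν_l(j)`.

NOT CLAIMED: the replica-exchange consequences (chapter R consumes `conveyor_poincare_of_cooling`; the `U`-form of
`Scaling/ReplicaExchangeModeGap` is left to a successor file); optimality of `16K(K+1)`.
Literature grade (cell rule): KNOWN MECHANISM (comparison paths for interchange / exclusion-type processes,
Diaconis–Saloff-Coste 1993; the rotation is the standard device of routing a path so that no low-weight block is
displaced), NEW RESULT for this chain (the `q`-free constant); nothing cited as a fact; no new bib keys.
-/

noncomputable section

open Finset Function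
open Literature.Probability.MarkovChains

namespace Summit.Ventures.LatticeQCDFlow.Scaling

section Rotation

variable {J : Type*} [Fintype J] [DecidableEq J] {K : ℕ} {ν : Fin (K + 1) → J → ℝ}
  {Q : Matrix (Fin (K + 1) → J) (Fin (K + 1) → J) ℝ}

/-! ## §0 Combinatorics of the rotation -/

omit [Fintype J] [DecidableEq J] in
/-- **After the fresh label has passed level `j+1`:** `insertNth (j+1) v r = insertNth j (r j) (update r j v)` — the
old label `r j` now sits at level `j`, inserted into the rest with `v` in its place. [ours] -/
theorem insertNth_succ_eq_insertNth_castSucc_update (j : Fin K) (v : J) (r : Fin K → J) :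
    (Fin.insertNth j.succ v r : Fin (K + 1) → J) = Fin.insertNth j.castSucc (r j) (update r j v) := by
  symm
  rw [Fin.insertNth_eq_iff]
  refine ⟨?_, ?_⟩
  · rw [← Fin.succAbove_succ_self j, Fin.insertNth_apply_succAbove]
  · funext i
    simp only [Fin.removeNth]
    by_cases hij : i = j
    · subst hij
      rw [update_self, Fin.succAbove_castSucc_self, Fin.insertNth_apply_same]
    · rw [update_of_ne hij]
      rcases lt_or_gt_of_ne hij with h | h
      · rw [Fin.succAbove_castSucc_of_lt j i h, ← Fin.succAbove_succ_of_le j i h.le,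
          Fin.insertNth_apply_succAbove]
      · rw [Fin.succAbove_castSucc_of_le j i h.le, ← Fin.succAbove_succ_of_lt j i h,
          Fin.insertNth_apply_succAbove]

omit [DecidableEq J] in
/-- Reindexing a double sum by the involution `(r, v) ↦ (update r j v, r j)`. [ours] -/
theorem sum_update_swap_eq (j : Fin K) (F : (Fin K → J) → J → ℝ) :
    ∑ r : Fin K → J, ∑ v : J, F (update r j v) (r j) = ∑ r : Fin K → J, ∑ v : J, F r v := by
  have hinv : Function.Involutive (fun q : (Fin K → J) × J => (update q.1 j q.2, q.1 j)) := by
    intro q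
    ext
    · simp only [update_idem, update_eq_self]
    · simp only [update_self]
  rw [← Fintype.sum_prod_type' (f := fun r v => F (update r j v) (r j)),
    ← Fintype.sum_prod_type' (f := fun r v => F r v)]
  exact Equiv.sum_comp hinv.toPerm (fun q : (Fin K → J) × J => F q.1 q.2)

omit [Fintype J] [DecidableEq J] in
/-- **One-level growth gives the block-heating factor `U = M^K`:** if `ν_{l+1}(j) ≤ M·ν_l(j)` (`1 ≤ M`, `ν ≥ 0`) then
`Π_i ν_{i+1}(r_i) ≤ M^K·Π_i ν_{t.succAbove i}(r_i)` for every `t` (the two products differ exactly at the indices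
`i < t`, read one level hotter on the right). [ours] -/
theorem prod_succ_le_growth (hν0 : ∀ k j, 0 ≤ ν k j) {M : ℝ} (hM1 : 1 ≤ M)
    (hM : ∀ (l : Fin K) (j : J), ν l.succ j ≤ M * ν l.castSucc j) (t : Fin (K + 1)) (r : Fin K → J) :
    ∏ i, ν i.succ (r i) ≤ M ^ K * ∏ i, ν (t.succAbove i) (r i) := by
  have h1 : ∏ i, ν i.succ (r i) ≤ ∏ i : Fin K, (M * ν (t.succAbove i) (r i)) := by
    refine prod_le_prod (fun i _ => hν0 _ _) fun i _ => ?_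
    by_cases hi : i.castSucc < t
    · rw [Fin.succAbove_of_castSucc_lt _ _ hi]; exact hM i (r i)
    · rw [Fin.succAbove_of_le_castSucc _ _ (not_lt.mp hi)]
      exact le_mul_of_one_le_left (hν0 _ _) hM1
  rw [prod_mul_distrib, prod_const, card_univ, Fintype.card_fin] at h1
  exact h1

/-! ## §1 The arm: a label riding between the hot end and level `m` -/

omit [DecidableEq J] in
/-- **THE ROTATION ARM.**  For `m ≤ k`:
`Σ_r Σ_v (Π_iν_{i+1}(r_i))·ν_k(v)·(f(insertNth 0 v r) − f(insertNth m v r))² ≤ (mU/(pκ))·Σ_lΣ_w ν⊗(w)Q(w,w∘σ_l)(f w − f(w∘σ_l))²`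
— Cauchy–Schwarz along the `m` transpositions; the transit state `insertNth t v r` (`t ≤ m ≤ k`) weighs at least
`(p/U)×` the served weight (`ν_t(v) ≥ p·ν_k(v)`, block read one level hotter `≥ U⁻¹`); each step is a bijective
image of `J × (Fin K → J)`. [ours] -/
theorem rotation_arm_le (hν0 : ∀ k j, 0 ≤ ν k j) {p U κ : ℝ} (hp : 0 < p) (hU : 0 < U) (hκ : 0 < κ)
    (hpers : ∀ (i k : Fin (K + 1)) (j : J), i ≤ k → p * ν k j ≤ ν i j)
    (hgrow : ∀ (t : Fin (K + 1)) (r : Fin K → J), ∏ i, ν i.succ (r i) ≤ U * ∏ i, ν (t.succAbove i) (r i))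
    (hQ0 : ∀ z y, 0 ≤ Q z y)
    (hT : ∀ (z : Fin (K + 1) → J) (l : Fin K), z ∘ Equiv.swap l.castSucc l.succ ≠ z →
      κ * min (tensorFun ν z) (tensorFun ν (z ∘ Equiv.swap l.castSucc l.succ))
        ≤ tensorFun ν z * Q z (z ∘ Equiv.swap l.castSucc l.succ))
    (f : (Fin (K + 1) → J) → ℝ) {m k : Fin (K + 1)} (hmk : m ≤ k) :
    ∑ r : Fin K → J, ∑ v : J, (∏ i, ν i.succ (r i)) * ν k v
        * (f (Fin.insertNth 0 v r) - f (Fin.insertNth m v r)) ^ 2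
      ≤ (m : ℝ) * U / (p * κ) * ∑ l : Fin K, ∑ w : Fin (K + 1) → J,
          tensorFun ν w * Q w (w ∘ Equiv.swap l.castSucc l.succ)
            * (f w - f (w ∘ Equiv.swap l.castSucc l.succ)) ^ 2 := by
  set T : Fin K → ℝ := fun l => ∑ w : Fin (K + 1) → J,
    tensorFun ν w * Q w (w ∘ Equiv.swap l.castSucc l.succ) * (f w - f (w ∘ Equiv.swap l.castSucc l.succ)) ^ 2
    with hTdef
  set I : J → (Fin K → J) → Fin (K + 1) → (Fin (K + 1) → J) := fun v r t => Fin.insertNth t v r with hI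
  have hW0 : ∀ z, 0 ≤ tensorFun ν z := fun z => prod_nonneg fun i _ => hν0 _ _
  have hB0 : ∀ r : Fin K → J, 0 ≤ ∏ i, ν i.succ (r i) := fun r => prod_nonneg fun i _ => hν0 _ _
  have hpκ : 0 < p * κ := mul_pos hp hκ
  -- the transit states carry the fraction `p/U` of the served weight
  have hwt : ∀ (t : Fin (K + 1)) (r : Fin K → J) (v : J), t ≤ k →
      p * ((∏ i, ν i.succ (r i)) * ν k v) ≤ U * tensorFun ν (I v r t) := by
    intro t r v htk
    simp only [hI, tensorFun_insertNth]
    calc p * ((∏ i, ν i.succ (r i)) * ν k v) = (∏ i, ν i.succ (r i)) * (p * ν k v) := by ring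
      _ ≤ (U * ∏ i, ν (t.succAbove i) (r i)) * ν t v :=
          mul_le_mul (hgrow t r) (hpers t k v htk) (mul_nonneg hp.le (hν0 _ _))
            (mul_nonneg hU.le (prod_nonneg fun i _ => hν0 _ _))
      _ = U * (ν t v * ∏ i, ν (t.succAbove i) (r i)) := by ring
  -- Cauchy–Schwarz along the arm
  have h1 : ∀ (r : Fin K → J) (v : J), (f (I v r 0) - f (I v r m)) ^ 2
      ≤ (m : ℝ) * ∑ l : Fin K, (if l.val < m.val then (f (I v r l.succ) - f (I v r l.castSucc)) ^ 2 else 0) := by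
    intro r v
    have h := sq_sub_head_le (fun i => f (I v r i)) m
    rw [show (f (I v r 0) - f (I v r m)) ^ 2 = (f (I v r m) - f (I v r 0)) ^ 2 by ring]
    exact h
  -- one transposition step, weighted
  have h2 : ∀ (r : Fin K → J) (v : J) (l : Fin K),
      (∏ i, ν i.succ (r i)) * ν k v
          * (if l.val < m.val then (f (I v r l.succ) - f (I v r l.castSucc)) ^ 2 else 0)
        ≤ U / (p * κ) * (tensorFun ν (I v r l.succ) * Q (I v r l.succ) (I v r l.succ ∘ Equiv.swap l.castSucc l.succ)
            * (f (I v r l.succ) - f (I v r l.succ ∘ Equiv.swap l.castSucc l.succ)) ^ 2) := by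
    intro r v l
    have hRHS0 : 0 ≤ U / (p * κ) * (tensorFun ν (I v r l.succ) * Q (I v r l.succ)
        (I v r l.succ ∘ Equiv.swap l.castSucc l.succ)
          * (f (I v r l.succ) - f (I v r l.succ ∘ Equiv.swap l.castSucc l.succ)) ^ 2) :=
      mul_nonneg (div_nonneg hU.le hpκ.le) (mul_nonneg (mul_nonneg (hW0 _) (hQ0 _ _)) (sq_nonneg _))
    split_ifs with hlm
    · have hcs : I v r l.castSucc = I v r l.succ ∘ Equiv.swap l.castSucc l.succ := by
        simp only [hI]; exact insertNth_castSucc_comp_swap l v r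
      by_cases hmove : I v r l.succ ∘ Equiv.swap l.castSucc l.succ = I v r l.succ
      · have e1 : f (I v r l.succ) - f (I v r l.castSucc) = 0 := by rw [hcs, hmove, sub_self]
        rw [e1, zero_pow two_ne_zero, mul_zero]
        exact hRHS0
      rw [← hcs]
      have hle1 : l.succ ≤ k := by
        refine le_trans ?_ hmk
        rw [Fin.le_iff_val_le_val, Fin.val_succ]; omega
      have hle2 : l.castSucc ≤ k := (Fin.castSucc_lt_succ (i := l)).le.trans hle1
      have w1 := hwt l.succ r v hle1
      have w2 := hwt l.castSucc r v hle2
      have wmin : p * ((∏ i, ν i.succ (r i)) * ν k v)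
          ≤ U * min (tensorFun ν (I v r l.succ)) (tensorFun ν (I v r l.castSucc)) := by
        rw [mul_min_of_nonneg _ _ hU.le]; exact le_min w1 w2
      have hflow := hT (I v r l.succ) l hmove
      rw [← hcs] at hflow
      have key : p * κ * ((∏ i, ν i.succ (r i)) * ν k v)
          ≤ U * (tensorFun ν (I v r l.succ) * Q (I v r l.succ) (I v r l.castSucc)) :=
        calc p * κ * ((∏ i, ν i.succ (r i)) * ν k v) = κ * (p * ((∏ i, ν i.succ (r i)) * ν k v)) := by ring
          _ ≤ κ * (U * min (tensorFun ν (I v r l.succ)) (tensorFun ν (I v r l.castSucc))) :=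
              mul_le_mul_of_nonneg_left wmin hκ.le
          _ = U * (κ * min (tensorFun ν (I v r l.succ)) (tensorFun ν (I v r l.castSucc))) := by ring
          _ ≤ U * (tensorFun ν (I v r l.succ) * Q (I v r l.succ) (I v r l.castSucc)) :=
              mul_le_mul_of_nonneg_left hflow hU.le
      have hle : (∏ i, ν i.succ (r i)) * ν k v
          ≤ U / (p * κ) * (tensorFun ν (I v r l.succ) * Q (I v r l.succ) (I v r l.castSucc)) := by
        rw [div_mul_eq_mul_div, le_div_iff₀ hpκ]
        calc (∏ i, ν i.succ (r i)) * ν k v * (p * κ) = p * κ * ((∏ i, ν i.succ (r i)) * ν k v) := by ring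
          _ ≤ U * (tensorFun ν (I v r l.succ) * Q (I v r l.succ) (I v r l.castSucc)) := key
      calc (∏ i, ν i.succ (r i)) * ν k v * (f (I v r l.succ) - f (I v r l.castSucc)) ^ 2
          ≤ U / (p * κ) * (tensorFun ν (I v r l.succ) * Q (I v r l.succ) (I v r l.castSucc))
              * (f (I v r l.succ) - f (I v r l.castSucc)) ^ 2 := mul_le_mul_of_nonneg_right hle (sq_nonneg _)
        _ = U / (p * κ) * (tensorFun ν (I v r l.succ) * Q (I v r l.succ) (I v r l.castSucc)
              * (f (I v r l.succ) - f (I v r l.castSucc)) ^ 2) := by ring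
    · rw [mul_zero]
      exact hRHS0
  -- reindex each step by the insertion bijection
  have h3 : ∀ l : Fin K, ∑ r : Fin K → J, ∑ v : J,
      tensorFun ν (I v r l.succ) * Q (I v r l.succ) (I v r l.succ ∘ Equiv.swap l.castSucc l.succ)
        * (f (I v r l.succ) - f (I v r l.succ ∘ Equiv.swap l.castSucc l.succ)) ^ 2 = T l := by
    intro l
    simp only [hI, hTdef]
    rw [← Equiv.sum_comp (Fin.insertNthEquiv (fun _ => J) l.succ) (fun w => tensorFun ν w
      * Q w (w ∘ Equiv.swap l.castSucc l.succ) * (f w - f (w ∘ Equiv.swap l.castSucc l.succ)) ^ 2),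
      Fintype.sum_prod_type, sum_comm]
    simp [Fin.insertNthEquiv]
  calc ∑ r : Fin K → J, ∑ v : J, (∏ i, ν i.succ (r i)) * ν k v * (f (I v r 0) - f (I v r m)) ^ 2
      ≤ ∑ r : Fin K → J, ∑ v : J, (∏ i, ν i.succ (r i)) * ν k v * ((m : ℝ) * ∑ l : Fin K,
          (if l.val < m.val then (f (I v r l.succ) - f (I v r l.castSucc)) ^ 2 else 0)) :=
        sum_le_sum fun r _ => sum_le_sum fun v _ =>
          mul_le_mul_of_nonneg_left (h1 r v) (mul_nonneg (hB0 r) (hν0 _ _))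
    _ = ∑ r : Fin K → J, ((m : ℝ) * ∑ l : Fin K, ∑ v : J, (∏ i, ν i.succ (r i)) * ν k v
          * (if l.val < m.val then (f (I v r l.succ) - f (I v r l.castSucc)) ^ 2 else 0)) := by
        refine sum_congr rfl fun r _ => ?_
        calc ∑ v : J, (∏ i, ν i.succ (r i)) * ν k v * ((m : ℝ) * ∑ l : Fin K,
              (if l.val < m.val then (f (I v r l.succ) - f (I v r l.castSucc)) ^ 2 else 0))
            = ∑ v : J, ∑ l : Fin K, (m : ℝ) * ((∏ i, ν i.succ (r i)) * ν k v
              * (if l.val < m.val then (f (I v r l.succ) - f (I v r l.castSucc)) ^ 2 else 0)) := by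
              refine sum_congr rfl fun v _ => ?_
              rw [mul_sum, mul_sum]
              exact sum_congr rfl fun l _ => by ring
          _ = ∑ l : Fin K, ∑ v : J, (m : ℝ) * ((∏ i, ν i.succ (r i)) * ν k v
              * (if l.val < m.val then (f (I v r l.succ) - f (I v r l.castSucc)) ^ 2 else 0)) := sum_comm
          _ = (m : ℝ) * ∑ l : Fin K, ∑ v : J, (∏ i, ν i.succ (r i)) * ν k v
              * (if l.val < m.val then (f (I v r l.succ) - f (I v r l.castSucc)) ^ 2 else 0) := by
              rw [mul_sum]
              exact sum_congr rfl fun l _ => by rw [mul_sum]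
    _ = (m : ℝ) * ∑ r : Fin K → J, ∑ l : Fin K, ∑ v : J, (∏ i, ν i.succ (r i)) * ν k v
          * (if l.val < m.val then (f (I v r l.succ) - f (I v r l.castSucc)) ^ 2 else 0) := by
        rw [← mul_sum]
    _ = (m : ℝ) * ∑ l : Fin K, ∑ r : Fin K → J, ∑ v : J, (∏ i, ν i.succ (r i)) * ν k v
          * (if l.val < m.val then (f (I v r l.succ) - f (I v r l.castSucc)) ^ 2 else 0) := by
        rw [sum_comm]
    _ ≤ (m : ℝ) * ∑ l : Fin K, ∑ r : Fin K → J, ∑ v : J, U / (p * κ)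
          * (tensorFun ν (I v r l.succ) * Q (I v r l.succ) (I v r l.succ ∘ Equiv.swap l.castSucc l.succ)
            * (f (I v r l.succ) - f (I v r l.succ ∘ Equiv.swap l.castSucc l.succ)) ^ 2) :=
        mul_le_mul_of_nonneg_left (sum_le_sum fun l _ => sum_le_sum fun r _ => sum_le_sum fun v _ =>
          h2 r v l) (Nat.cast_nonneg _)
    _ = (m : ℝ) * ∑ l : Fin K, U / (p * κ) * T l := by
        congr 1
        refine sum_congr rfl fun l _ => ?_
        rw [← h3 l, mul_sum]
        exact sum_congr rfl fun r _ => by rw [mul_sum]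
    _ = (m : ℝ) * U / (p * κ) * ∑ l : Fin K, T l := by
        rw [← mul_sum, ← mul_assoc, mul_div_assoc]

/-! ## §2 The source: relabelling at the hot end against a `ν_k`-weighted partner -/

/-- **THE ROTATION SOURCE.**
`Σ_r Σ_a Σ_v ν_0(a)(Π_iν_{i+1}(r_i))ν_k(v)(f(insertNth 0 a r) − f(insertNth 0 v r))² ≤ (2/(pρθ))·½Σ_zΣ_v ν⊗(z)Q(z,z⁰ᵛ)(f z − f z⁰ᵛ)²`:
`ν_k(v) ≤ p⁻¹ν_0(v)`, the hot chain's Poincaré inequality, domination at the hot position. [ours] -/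
theorem rotation_source_le (hν0 : ∀ k j, 0 ≤ ν k j) (hν1 : ∀ k, ∑ j, ν k j = 1) {p ρ θ : ℝ}
    (hp : 0 < p) (hρ : 0 < ρ) (hθ : 0 < θ)
    (hpers : ∀ (i k : Fin (K + 1)) (j : J), i ≤ k → p * ν k j ≤ ν i j)
    {Q₀ : Matrix J J ℝ} (hρvar : ∀ h : J → ℝ, ρ * lawVariance (ν 0) h ≤ dirichletForm (ν 0) Q₀ h)
    (hR : ∀ (z : Fin (K + 1) → J) (v : J), v ≠ z 0 →
      θ * (tensorFun ν z * Q₀ (z 0) v) ≤ tensorFun ν z * Q z (update z 0 v))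
    (f : (Fin (K + 1) → J) → ℝ) (k : Fin (K + 1)) :
    ∑ r : Fin K → J, ∑ a : J, ∑ v : J, ν 0 a * (∏ i, ν i.succ (r i)) * ν k v
        * (f (Fin.insertNth 0 a r) - f (Fin.insertNth 0 v r)) ^ 2
      ≤ 2 / (p * ρ * θ) * ((1 / 2) * ∑ z : Fin (K + 1) → J, ∑ v,
          tensorFun ν z * Q z (update z 0 v) * (f z - f (update z 0 v)) ^ 2) := by
  set R0 : (Fin K → J) → ℝ := fun r => ∏ i, ν i.succ (r i) with hR0
  set h : (Fin K → J) → J → ℝ := fun r a => f (Fin.insertNth 0 a r) with hh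
  have hR00 : ∀ r, 0 ≤ R0 r := fun r => prod_nonneg fun j _ => hν0 _ _
  have hpρ : 0 < p * ρ := mul_pos hp hρ
  have hall : 0 < p * ρ * θ := by positivity
  -- Step 1: factor the block weight
  have L1 : ∑ r : Fin K → J, ∑ a : J, ∑ v : J, ν 0 a * R0 r * ν k v
        * (f (Fin.insertNth 0 a r) - f (Fin.insertNth 0 v r)) ^ 2
      = ∑ r : Fin K → J, R0 r * ∑ a, ∑ v, ν 0 a * ν k v * (h r a - h r v) ^ 2 := by
    refine sum_congr rfl fun r _ => ?_
    rw [mul_sum]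
    refine sum_congr rfl fun a _ => ?_
    rw [mul_sum]
    refine sum_congr rfl fun v _ => ?_
    simp only [hh]
    ring
  -- Step 2: `ν_k ≤ p⁻¹ν_0`, twice a `ν_0`-variance, the hot chain's Poincaré inequality
  have L2 : ∀ r, ∑ a, ∑ v, ν 0 a * ν k v * (h r a - h r v) ^ 2
      ≤ 1 / (p * ρ) * ∑ a, ∑ v, ν 0 a * Q₀ a v * (h r a - h r v) ^ 2 := by
    intro r
    have e1 : ∑ a, ∑ v, ν 0 a * ν k v * (h r a - h r v) ^ 2
        ≤ 1 / p * ∑ a, ∑ v, ν 0 a * ν 0 v * (h r a - h r v) ^ 2 := by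
      rw [mul_sum]
      refine sum_le_sum fun a _ => ?_
      rw [mul_sum]
      refine sum_le_sum fun v _ => ?_
      have hv : ν k v ≤ 1 / p * ν 0 v := by
        rw [one_div, inv_mul_eq_div, le_div_iff₀ hp, mul_comm]; exact hpers 0 k v (Fin.zero_le _)
      calc ν 0 a * ν k v * (h r a - h r v) ^ 2 ≤ ν 0 a * (1 / p * ν 0 v) * (h r a - h r v) ^ 2 :=
            mul_le_mul_of_nonneg_right (mul_le_mul_of_nonneg_left hv (hν0 _ _)) (sq_nonneg _)
        _ = 1 / p * (ν 0 a * ν 0 v * (h r a - h r v) ^ 2) := by ring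
    have e2 : ∑ a, ∑ v, ν 0 a * ν 0 v * (h r a - h r v) ^ 2 = 2 * lawVariance (ν 0) (h r) := by
      rw [lawVariance_eq_half_sum (hν1 0)]
      rw [← mul_assoc, show (2 : ℝ) * (1 / 2) = 1 by norm_num, one_mul]
      exact sum_congr rfl fun a _ => sum_congr rfl fun v _ => by ring
    have e4 : lawVariance (ν 0) (h r) ≤ 1 / ρ * dirichletForm (ν 0) Q₀ (h r) := by
      rw [one_div, inv_mul_eq_div, le_div_iff₀ hρ, mul_comm]
      exact hρvar (h r)
    have e5 : dirichletForm (ν 0) Q₀ (h r) = (1 / 2) * ∑ a, ∑ v, ν 0 a * Q₀ a v * (h r a - h r v) ^ 2 := rfl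
    calc ∑ a, ∑ v, ν 0 a * ν k v * (h r a - h r v) ^ 2
        ≤ 1 / p * (2 * lawVariance (ν 0) (h r)) := by rw [← e2]; exact e1
      _ ≤ 1 / p * (2 * (1 / ρ * ((1 / 2) * ∑ a, ∑ v, ν 0 a * Q₀ a v * (h r a - h r v) ^ 2))) := by
          rw [← e5]
          exact mul_le_mul_of_nonneg_left (mul_le_mul_of_nonneg_left e4 (by norm_num)) (by positivity)
      _ = 1 / (p * ρ) * ∑ a, ∑ v, ν 0 a * Q₀ a v * (h r a - h r v) ^ 2 := by
          field_simp
  -- Step 3: domination at the hot position, then back to a sum over states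
  have L3 : ∀ r a v, θ * (ν 0 a * R0 r * Q₀ a v * (h r a - h r v) ^ 2)
      ≤ tensorFun ν (Fin.insertNth 0 a r) * Q (Fin.insertNth 0 a r) (update (Fin.insertNth 0 a r) 0 v)
          * (f (Fin.insertNth 0 a r) - f (update (Fin.insertNth 0 a r : Fin (K + 1) → J) 0 v)) ^ 2 := by
    intro r a v
    have hW : tensorFun ν (Fin.insertNth 0 a r) = ν 0 a * R0 r := by
      rw [tensorFun_insertNth]; simp [hR0]
    by_cases hva : v = a
    · subst hva
      simp only [hh, Fin.update_insertNth, sub_self]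
      simp
    · have hd := hR (Fin.insertNth 0 a r) v (by rwa [Fin.insertNth_apply_same])
      rw [Fin.insertNth_apply_same, hW] at hd
      simp only [Fin.update_insertNth] at hd
      simp only [hh, Fin.update_insertNth]
      rw [hW]
      calc θ * (ν 0 a * R0 r * Q₀ a v * (f (Fin.insertNth 0 a r) - f (Fin.insertNth 0 v r)) ^ 2)
          = θ * (ν 0 a * R0 r * Q₀ a v) * (f (Fin.insertNth 0 a r) - f (Fin.insertNth 0 v r)) ^ 2 := by ring
        _ ≤ ν 0 a * R0 r * Q (Fin.insertNth 0 a r) (Fin.insertNth 0 v r)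
              * (f (Fin.insertNth 0 a r) - f (Fin.insertNth 0 v r)) ^ 2 :=
            mul_le_mul_of_nonneg_right hd (sq_nonneg _)
  have L4 : ∑ r : Fin K → J, ∑ a, ∑ v, tensorFun ν (Fin.insertNth 0 a r)
        * Q (Fin.insertNth 0 a r) (update (Fin.insertNth 0 a r) 0 v)
        * (f (Fin.insertNth 0 a r) - f (update (Fin.insertNth 0 a r : Fin (K + 1) → J) 0 v)) ^ 2
      = ∑ z : Fin (K + 1) → J, ∑ v, tensorFun ν z * Q z (update z 0 v) * (f z - f (update z 0 v)) ^ 2 := by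
    rw [← Equiv.sum_comp (Fin.insertNthEquiv (fun _ => J) 0) (fun z : Fin (K + 1) → J => ∑ v,
      tensorFun ν z * Q z (update z 0 v) * (f z - f (update z 0 v)) ^ 2), Fintype.sum_prod_type, sum_comm]
    simp [Fin.insertNthEquiv]
  -- assembly
  rw [L1]
  calc ∑ r : Fin K → J, R0 r * ∑ a, ∑ v, ν 0 a * ν k v * (h r a - h r v) ^ 2
      ≤ ∑ r : Fin K → J, R0 r * (1 / (p * ρ) * ∑ a, ∑ v, ν 0 a * Q₀ a v * (h r a - h r v) ^ 2) :=
        sum_le_sum fun r _ => mul_le_mul_of_nonneg_left (L2 r) (hR00 r)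
    _ = 1 / (p * ρ * θ) * ∑ r : Fin K → J, ∑ a, ∑ v,
          θ * (ν 0 a * R0 r * Q₀ a v * (h r a - h r v) ^ 2) := by
        simp only [mul_sum]
        refine sum_congr rfl fun r _ => sum_congr rfl fun a _ => sum_congr rfl fun v _ => ?_
        field_simp
    _ ≤ 1 / (p * ρ * θ) * ∑ r : Fin K → J, ∑ a, ∑ v, tensorFun ν (Fin.insertNth 0 a r)
          * Q (Fin.insertNth 0 a r) (update (Fin.insertNth 0 a r) 0 v)
          * (f (Fin.insertNth 0 a r) - f (update (Fin.insertNth 0 a r : Fin (K + 1) → J) 0 v)) ^ 2 :=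
        mul_le_mul_of_nonneg_left
          (sum_le_sum fun r _ => sum_le_sum fun a _ => sum_le_sum fun v _ => L3 r a v) (by positivity)
    _ = 2 / (p * ρ * θ) * ((1 / 2) * ∑ z : Fin (K + 1) → J, ∑ v,
          tensorFun ν z * Q z (update z 0 v) * (f z - f (update z 0 v)) ^ 2) := by
        rw [L4]
        ring

end Rotation

end Summit.Ventures.LatticeQCDFlow.Scaling
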